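import Mathlib
import HarnessLib
import Literature.Analysis.FluidPDE.VectorCalculus
import Literature.Analysis.FluidPDE.VorticityCalculus
import Literature.Analysis.FluidPDE.CurlFreeLiouville
import Summits.NavierStokesRegularity.NavierStokesRegularity.Theorems.UnthreadedDoorAntidynamoSingleDegreeVorticity
import Summits.NavierStokesRegularity.NavierStokesRegularity.Theorems.UnthreadedDoorAntidynamoEvenRungOdeBranch

/-!
# Route `UnthreadedDoor` / `ThreadingFlux`, crux `PoloidalLiouville` (stmt-NavierStokesRegularity-1222), antidynamo v2 skeleton,
# rung `stub_singleDegreeRung`, EVEN degree — THE CENTRE PACKAGE: analyticity of the vorticity amplitude, the centre bound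
# `|ĝ| r^l = O(1)`, and closure of the branch `ĝ ≡ 0` to slice constancy, all FROM THE RUNG'S OWN HYPOTHESES

Support file (census instrument decomp-ns-census-1 g32, cell decomp-ns; `--supports stmt-NavierStokesRegularity-1222 --as helper`; 0 kit).

State of the even rung before this file (tree, by name): the hand's step S2 `singleDegree_vorticity_structure` (p797227) gives, at every
slice, `curl (v t) x = ĝ(‖x − x₀‖) • (∇P(x − x₀) × (x − x₀))` off the centre with `ĝ` of class `C^ω` on `(0,∞)`; the census's
`evenRung_slice_alternative` (p810995, on top of p800175 → p800631 → p810874 → p809884) turns the single-degree vorticity identity at one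
slice into `G ≡ 0 on (0,∞)` OR `l = 2 ∧ P zonal`, but ASSUMES (besides the kinematic normal form `G = a − k′/r`, the divergence relation and
the identity) two facts about `G` — real-analyticity on `(0,∞)` (`hGan`) and the CENTRE BOUND `|G(r)|·r^l ≤ C` on `(0,1)` (`hbdd`) — and
leaves its first alternative as «the vorticity amplitude vanishes off the centre».

THIS FILE discharges both facts from the rung's verbatim hypotheses and closes the first alternative:

* `exists_unit_cross_gradient_ne_zero` — a non-zero harmonic positively homogeneous `C^ω` profile `Q` of degree `l ≥ 1` has a UNIT vector
  `ξ` with `Λ ξ = ∇Q(ξ) × ξ ≠ 0` (p797063 `exists_cross_gradient_ne_zero_of_isOpen` on `{0}ᶜ`, normalised along the ray by p796008).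
* `centreBound_of_continuous` (pure) — `Λ` positively homogeneous of degree `l`, `Λ ξ ≠ 0` for a unit `ξ`, `w` CONTINUOUS with
  `w x = G(‖x − x₀‖) • Λ(x − x₀)` off `x₀` ⟹ `∃ C, ∀ r ∈ (0,1), |G r|·r^l ≤ C` [sup of `‖w‖` on the closed unit ball about `x₀`, read
  along the ray `x₀ + rξ`: `‖w(x₀ + rξ)‖ = |G r|·r^l·‖Λ ξ‖`].
* `eq_zero_of_vortAmp_eq_zero` (pure) — `G ≡ 0` on `(0,∞)` + the representation + `w` continuous ⟹ `w ≡ 0` (also at the centre: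
  `{x₀}ᶜ` is dense and the zero set of `w` is closed).
* `vortAmp_eq_of_repr` (pure) — two coefficients representing the same field off `x₀` agree on `(0,∞)` (read along the ray `x₀ + rξ`).
* ★★ `singleDegree_vorticity_structure_centre` — UNDER THE RUNG'S VERBATIM HYPOTHESES (`P ≠ 0`): at every `t < 0` there is `ĝ`,
  REAL-ANALYTIC on `(0,∞)` (`AnalyticOnNhd`, the letter of p810995's `hGan`), with the representation of `curl (v t)` off `x₀`, the CENTRE
  BOUND (the letter of p810995's `hbdd`; from `continuous_curl`), and `(∀ r > 0, ĝ r = 0) → ∃ b, ∀ x, v t x = b` (vorticity vanishes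
  everywhere by continuity; bounded + divergence-free + curl-free ⟹ constant, Literature `eq_of_curl_eq_zero_of_isDivFree_of_bounded`).
* ★★ `evenRung_slice_alternative_of_rung` — UNDER THE RUNG'S VERBATIM HYPOTHESES (`P ≠ 0`), at one slice `t < 0`: ANY data
  `(ĝ, a, k, c, e)` with the vorticity representation via `ĝ`, `a k c e` differentiable on `(0,∞)`, `ĝ = a − k′/r`, the divergence relation
  `r a′ + (l+3)a + l k′/r = 0` and the single-degree vorticity identity of `evenRung_dichotomy_of_laplacian` (p810874) with `d := ĝ·k`
  ⟹ `(∃ b, ∀ x, v t x = b) ∨ (l = 2 ∧ ∇P coaxial)`; and `slice_const_of_rung_of_three_le`: for `l ≥ 3` the slice IS constant.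

MEANING for the (E1) hand: after this file the even rung's remaining deliverables at a slice are EXACTLY the kinematic normal form
(`a, k` differentiable with `ĝ = a − k′/r` and the divergence relation), the radial coefficients `c, e`, and the identity `hid` obtained by
curling the vorticity equation — nothing about analyticity of `ĝ`, the centre, or the `ĝ ≡ 0` branch; for `l ≥ 3` that closes the slice,
for `l = 2` the zonal quadratic goes to the KNSS transfer; the WALL `stub_scalarLiouville` is untouched.

HONEST LABEL: elementary (compactness, density, homogeneity along rays) plus composition of tree theorems, serving the open EVEN-degree
rung of an S-free Liouville engine; the rung, the wall, `PoloidalLiouville` (1222) and Navier–Stokes regularity are NOT touched (crux 1222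
is INCOMPARABLE with the summit; descent inside the door's cone, decorative for the summit).  Nothing here proves NavierStokesRegularity.
[folklore]
-/

noncomputable section

-- the summit and its single sub-problem share the name (CONVENTIONS §1), as in every Theorems file
set_option linter.dupNamespace false

open scoped Topology InnerProductSpace RealInnerProductSpace ContDiff
open Filter Set Metric MeasureTheory MvPolynomial
open Literature.Analysis.FluidPDE

namespace Summit.NavierStokesRegularity.NavierStokesRegularity.Theorems.PoloidalLiouville.Antidynamo

open Summit.NavierStokesRegularity.NavierStokesRegularity.Theorems.UnthreadedRigidity.VirialHorn (det3)

/-! ### Pure lemmas: a field `w x = G(‖x − x₀‖) • Λ(x − x₀)` off a centre, `Λ` positively homogeneous -/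

/-- **CENTRE BOUND.**  If `Λ` is positively homogeneous of degree `l`, `Λ ξ ≠ 0` for some unit vector `ξ`, and a CONTINUOUS field `w`
has the form `w x = G(‖x − x₀‖) • Λ(x − x₀)` off `x₀`, then `|G r|·r^l` is bounded on `(0,1)`: it equals `‖w(x₀ + rξ)‖ / ‖Λ ξ‖`, and `w`
is bounded on the closed unit ball about `x₀`. [folklore] -/
theorem centreBound_of_continuous {Λ w : EuclideanSpace ℝ (Fin 3) → EuclideanSpace ℝ (Fin 3)} {l : ℕ}
    (hΛ : ∀ r : ℝ, 0 < r → ∀ y : EuclideanSpace ℝ (Fin 3), Λ (r • y) = r ^ l • Λ y)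
    {ξ : EuclideanSpace ℝ (Fin 3)} (hξ1 : ‖ξ‖ = 1) (hξ : Λ ξ ≠ 0)
    {x₀ : EuclideanSpace ℝ (Fin 3)} (hw : Continuous w) {G : ℝ → ℝ}
    (hrep : ∀ x, x ≠ x₀ → w x = G ‖x - x₀‖ • Λ (x - x₀)) :
    ∃ C, ∀ r, 0 < r → r < 1 → |G r| * r ^ l ≤ C := by
  obtain ⟨M, hM⟩ := (isCompact_closedBall x₀ 1).exists_bound_of_continuousOn hw.continuousOn
  have hΛpos : 0 < ‖Λ ξ‖ := norm_pos_iff.mpr hξ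
  have hξ0 : ξ ≠ 0 := by
    intro h
    rw [h, norm_zero] at hξ1
    exact zero_ne_one hξ1
  refine ⟨M / ‖Λ ξ‖, fun r hr hr1 => ?_⟩
  rw [le_div_iff₀ hΛpos]
  have hn : ‖r • ξ‖ = r := by rw [norm_smul, Real.norm_eq_abs, abs_of_pos hr, hξ1, mul_one]
  have hx : x₀ + r • ξ ≠ x₀ := by
    intro h
    have h' : r • ξ = 0 := by simpa using h
    exact smul_ne_zero hr.ne' hξ0 h'
  have hmem : x₀ + r • ξ ∈ closedBall x₀ 1 := by
    rw [mem_closedBall, dist_eq_norm, add_sub_cancel_left, hn]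
    exact hr1.le
  have hwx : w (x₀ + r • ξ) = (G r * r ^ l) • Λ ξ := by
    rw [hrep _ hx, add_sub_cancel_left, hn, hΛ r hr ξ, smul_smul]
  have h1 := hM _ hmem
  rw [hwx, norm_smul, Real.norm_eq_abs, abs_mul, abs_of_pos (pow_pos hr l)] at h1
  exact h1

/-- **THE BRANCH `G ≡ 0` MEANS `w ≡ 0`, CENTRE INCLUDED.**  If `G` vanishes on `(0,∞)` and the continuous field `w` has the form
`w x = G(‖x − x₀‖) • Λ(x − x₀)` off `x₀`, then `w` vanishes identically (`{x₀}ᶜ` is dense, the zero set of `w` is closed). [folklore] -/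
theorem eq_zero_of_vortAmp_eq_zero {Λ w : EuclideanSpace ℝ (Fin 3) → EuclideanSpace ℝ (Fin 3)}
    {x₀ : EuclideanSpace ℝ (Fin 3)} (hw : Continuous w) {G : ℝ → ℝ}
    (hrep : ∀ x, x ≠ x₀ → w x = G ‖x - x₀‖ • Λ (x - x₀)) (hG : ∀ r, 0 < r → G r = 0) :
    ∀ x, w x = 0 := by
  have hoff : ∀ x, x ≠ x₀ → w x = 0 := fun x hx => by
    rw [hrep x hx, hG _ (norm_pos_iff.mpr (sub_ne_zero.mpr hx)), zero_smul]
  have hcl : IsClosed {x : EuclideanSpace ℝ (Fin 3) | w x = 0} := isClosed_eq hw continuous_const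
  have hsub : ({x₀}ᶜ : Set (EuclideanSpace ℝ (Fin 3))) ⊆ {x | w x = 0} := fun x hx => hoff x hx
  have huniv : closure ({x₀}ᶜ : Set (EuclideanSpace ℝ (Fin 3))) ⊆ {x | w x = 0} :=
    hcl.closure_subset_iff.mpr hsub
  rw [(dense_compl_singleton x₀).closure_eq] at huniv
  exact fun x => huniv (mem_univ x)

/-- **UNIQUENESS OF THE AMPLITUDE.**  Two radial coefficients representing the same field off `x₀` against a positively homogeneous `Λ`
with `Λ ξ ≠ 0` for a unit `ξ` agree on `(0,∞)` (read both along the ray `x₀ + rξ`). [folklore] -/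
theorem vortAmp_eq_of_repr {Λ w : EuclideanSpace ℝ (Fin 3) → EuclideanSpace ℝ (Fin 3)} {l : ℕ}
    (hΛ : ∀ r : ℝ, 0 < r → ∀ y : EuclideanSpace ℝ (Fin 3), Λ (r • y) = r ^ l • Λ y)
    {ξ : EuclideanSpace ℝ (Fin 3)} (hξ1 : ‖ξ‖ = 1) (hξ : Λ ξ ≠ 0)
    {x₀ : EuclideanSpace ℝ (Fin 3)} {G G' : ℝ → ℝ}
    (hrep : ∀ x, x ≠ x₀ → w x = G ‖x - x₀‖ • Λ (x - x₀))
    (hrep' : ∀ x, x ≠ x₀ → w x = G' ‖x - x₀‖ • Λ (x - x₀)) :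
    ∀ r, 0 < r → G r = G' r := by
  intro r hr
  have hξ0 : ξ ≠ 0 := by
    intro h
    rw [h, norm_zero] at hξ1
    exact zero_ne_one hξ1
  have hn : ‖r • ξ‖ = r := by rw [norm_smul, Real.norm_eq_abs, abs_of_pos hr, hξ1, mul_one]
  have hx : x₀ + r • ξ ≠ x₀ := by
    intro h
    have h' : r • ξ = 0 := by simpa using h
    exact smul_ne_zero hr.ne' hξ0 h'
  have h1 := hrep _ hx
  rw [hrep' _ hx, add_sub_cancel_left, hn, hΛ r hr ξ, smul_smul, smul_smul] at h1
  -- `h1 : (G' r * r ^ l) • Λ ξ = (G r * r ^ l) • Λ ξ`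
  have h2 : (G' r * r ^ l - G r * r ^ l) • Λ ξ = 0 := by rw [sub_smul, h1, sub_self]
  rcases smul_eq_zero.mp h2 with h3 | h3
  · have hrl : r ^ l ≠ 0 := pow_ne_zero l hr.ne'
    have : (G' r - G r) * r ^ l = 0 := by rw [sub_mul]; exact h3
    rcases mul_eq_zero.mp this with h4 | h4
    · linarith
    · exact absurd h4 hrl
  · exact absurd h3 hξ

/-! ### The profile: a unit vector where `Λ = ∇Q × id` does not vanish -/

/-- For a non-zero harmonic positively homogeneous `C^ω` profile `Q` of degree `l ≥ 1` there is a UNIT vector `ξ` with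
`∇Q(ξ) × ξ ≠ 0` (density of `{Λ ≠ 0}`, p797063, on the open set `{0}ᶜ` — nonempty since `Q 0 = 0 ≠ Q y₁`, p796595; then normalise
along the ray, p796008). [folklore] -/
theorem exists_unit_cross_gradient_ne_zero {Q : EuclideanSpace ℝ (Fin 3) → ℝ} (hQ : ContDiff ℝ ω Q) {l : ℕ} (hl : 1 ≤ l)
    (hhom : ∀ r : ℝ, 0 < r → ∀ y : EuclideanSpace ℝ (Fin 3), Q (r • y) = r ^ l * Q y)
    (hharm : ∀ y, Laplacian.laplacian Q y = 0) (hne : ∃ y, Q y ≠ 0) :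
    ∃ ξ : EuclideanSpace ℝ (Fin 3), ‖ξ‖ = 1 ∧ cross (gradient Q ξ) ξ ≠ 0 := by
  have hW : IsOpen ({0}ᶜ : Set (EuclideanSpace ℝ (Fin 3))) := isOpen_compl_singleton
  -- `{0}ᶜ` is nonempty: `Q 0 = 0` (homogeneity, `l ≥ 1`) while `Q ≢ 0`
  have hWne : ({0}ᶜ : Set (EuclideanSpace ℝ (Fin 3))).Nonempty := by
    obtain ⟨y₁, hy₁⟩ := hne
    refine ⟨y₁, fun h => hy₁ ?_⟩
    rw [mem_singleton_iff.mp h]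
    exact eq_zero_at_zero_of_homogeneous hl hhom
  obtain ⟨y, hy0, hy⟩ := exists_cross_gradient_ne_zero_of_isOpen hQ hl hhom hharm hne hW hWne
  have hy0' : y ≠ 0 := hy0
  have hypos : 0 < ‖y‖ := norm_pos_iff.mpr hy0'
  refine ⟨‖y‖⁻¹ • y, ?_, ?_⟩
  · rw [norm_smul, norm_inv, norm_norm, inv_mul_cancel₀ hypos.ne']
  · exact cross_gradient_ne_zero_smul (hQ.differentiable (by simp)) hhom hy (inv_pos.mpr hypos)

/-! ### The rung's letter: analyticity, centre bound and the `ĝ ≡ 0` branch from the class -/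

/-- ★★ **S2 WITH THE CENTRE PACKAGE, UNDER THE RUNG'S VERBATIM HYPOTHESES** (non-zero profile).  For a bounded ancient mild solution
(duality class, `ν = 1`) with measurable slices, jointly smooth on `(−∞,0) × ℝ³`, whose slices have the single-degree form
`v t x = gradient φ x + (g ‖x − x₀‖ · P(x − x₀)) • (x − x₀)` (`φ`, `g` arbitrary at each `t`; `P ≠ 0` harmonic, homogeneous of degree
`l ≥ 2`), at every `t < 0` there is `ĝ : ℝ → ℝ` with: (a) `ĝ` REAL-ANALYTIC on `(0,∞)`; (b) `curl (v t) x = ĝ(‖x − x₀‖) • (∇P(x − x₀) ×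
(x − x₀))` for `x ≠ x₀`; (c) the CENTRE BOUND `∃ C, ∀ r ∈ (0,1), |ĝ r|·r^l ≤ C`; (d) if `ĝ ≡ 0` on `(0,∞)` the slice is constant.
[(a),(b): p797227 + `IsOpen.analyticOn_iff_analyticOnNhd`; (c): `centreBound_of_continuous` with `continuous_curl`; (d):
`eq_zero_of_vortAmp_eq_zero` + Literature `eq_of_curl_eq_zero_of_isDivFree_of_bounded`.] [folklore] -/
theorem singleDegree_vorticity_structure_centre
    (v : ℝ → EuclideanSpace ℝ (Fin 3) → EuclideanSpace ℝ (Fin 3)) (x₀ : EuclideanSpace ℝ (Fin 3))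
    (hB : Literature.Analysis.FluidPDE.IsBoundedAncientMildSolution 1 v)
    (hm : ∀ t < 0, AEStronglyMeasurable (v t) volume)
    (hsm : ContDiffOn ℝ (⊤ : ℕ∞) (Function.uncurry v) (Set.Iio 0 ×ˢ Set.univ))
    {l : ℕ} {P : MvPolynomial (Fin 3) ℝ} (hl : 2 ≤ l) (hP : P.IsHomogeneous l) (hP0 : P ≠ 0)
    (hharm : ∀ y : EuclideanSpace ℝ (Fin 3),
      Laplacian.laplacian (fun z : EuclideanSpace ℝ (Fin 3) => MvPolynomial.eval (fun i => z i) P) y = 0)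
    (hrep : ∀ t < 0, ∃ (g : ℝ → ℝ) (φ : EuclideanSpace ℝ (Fin 3) → ℝ), ∀ x,
      v t x = gradient φ x + (g ‖x - x₀‖ * MvPolynomial.eval (fun i => (x - x₀) i) P) • (x - x₀)) :
    ∀ t < 0, ∃ ĝ : ℝ → ℝ, AnalyticOnNhd ℝ ĝ (Ioi 0) ∧
      (∀ x : EuclideanSpace ℝ (Fin 3), x ≠ x₀ →
        curl (v t) x = ĝ ‖x - x₀‖ •
          cross (gradient (fun z : EuclideanSpace ℝ (Fin 3) => MvPolynomial.eval (fun i => z i) P) (x - x₀)) (x - x₀)) ∧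
      (∃ C, ∀ r, 0 < r → r < 1 → |ĝ r| * r ^ l ≤ C) ∧
      ((∀ r, 0 < r → ĝ r = 0) → ∃ b : EuclideanSpace ℝ (Fin 3), ∀ x, v t x = b) := by
  intro t ht
  obtain ⟨ĝ, hĝω, hcurl⟩ := singleDegree_vorticity_structure v x₀ hB hm hsm hl hP hP0 hharm hrep t ht
  -- the profile
  set Q : EuclideanSpace ℝ (Fin 3) → ℝ := fun z => MvPolynomial.eval (fun i => z i) P with hQ
  have hQω : ContDiff ℝ ω Q := contDiff_omega_evalPoly P
  have hQhom : ∀ r : ℝ, 0 < r → ∀ y : EuclideanSpace ℝ (Fin 3), Q (r • y) = r ^ l * Q y :=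
    fun r _ y => evalPoly_smul hP r y
  have hl1 : 1 ≤ l := by omega
  have hQne : ∃ y, Q y ≠ 0 := exists_evalPoly_ne_zero hP0
  obtain ⟨ξ, hξ1, hξ⟩ := exists_unit_cross_gradient_ne_zero hQω hl1 hQhom hharm hQne
  have hΛhom : ∀ r : ℝ, 0 < r → ∀ y : EuclideanSpace ℝ (Fin 3),
      cross (gradient Q (r • y)) (r • y) = r ^ l • cross (gradient Q y) y :=
    fun r hr y => cross_gradient_smul_of_homogeneous (hQω.differentiable (by simp)) hQhom hr y
  -- the slice
  have hsm' : IsSmoothSpaceTimeOn (Iio 0) v := hsm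
  have hvt : ContDiff ℝ ∞ (v t) := hsm'.contDiff_slice ht
  have hv1 : ContDiff ℝ 1 (v t) := hvt.of_le (by norm_cast)
  have hv2 : ContDiff ℝ 2 (v t) := hvt.of_le (by norm_cast)
  have hwc : Continuous (curl (v t)) := continuous_curl hv1
  refine ⟨ĝ, (isOpen_Ioi.analyticOn_iff_analyticOnNhd).mp hĝω.analyticOn, hcurl, ?_, ?_⟩
  · exact centreBound_of_continuous (Λ := fun y => cross (gradient Q y) y) hΛhom hξ1 hξ hwc hcurl
  · intro hG
    have hzero : ∀ x, curl (v t) x = 0 :=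
      eq_zero_of_vortAmp_eq_zero (Λ := fun y => cross (gradient Q y) y) hwc hcurl hG
    have hdiv : VectorCalculus.IsDivFree (v t) := (hB.isAncientMildSolution.1 t ht).isDivFree_of_contDiff hv1
    obtain ⟨M, hM⟩ := hB.isBoundedOn
    exact ⟨v t 0, fun x => eq_of_curl_eq_zero_of_isDivFree_of_bounded hv2 hzero hdiv (fun y => hM t ht y) x 0⟩

/-- ★★ **THE EVEN RUNG AT ONE SLICE, MODULO THE (E1) DATA ONLY.**  Under the rung's VERBATIM hypotheses (`P ≠ 0`), fix `t < 0` and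
ANY data `(ĝ, a, k, c, e)`: a coefficient `ĝ` representing `curl (v t)` off `x₀`, `a k c e` differentiable on `(0,∞)`, the kinematic normal
form `ĝ = a − k′/r` with the divergence relation `r a′ + (l+3)a + l k′/r = 0`, and the single-degree vorticity identity of
`evenRung_dichotomy_of_laplacian` (p810874) with `d := ĝ·k`.  Then EITHER the slice is constant OR `l = 2` and `∇P` is coaxial
(`P` a zonal quadratic).  [`ĝ` agrees on `(0,∞)` with the analytic coefficient of `singleDegree_vorticity_structure_centre`
(`vortAmp_eq_of_repr`), so it is analytic and obeys the centre bound; p810874 splits `d ≡ 0 ∨ zonal`; on `d ≡ 0`,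
`odeBranch_vortAmp_eq_zero` (p810995) gives `ĝ ≡ 0`, hence a constant slice.] [folklore] -/
theorem evenRung_slice_alternative_of_rung
    (v : ℝ → EuclideanSpace ℝ (Fin 3) → EuclideanSpace ℝ (Fin 3)) (x₀ : EuclideanSpace ℝ (Fin 3))
    (hB : Literature.Analysis.FluidPDE.IsBoundedAncientMildSolution 1 v)
    (hm : ∀ t < 0, AEStronglyMeasurable (v t) volume)
    (hsm : ContDiffOn ℝ (⊤ : ℕ∞) (Function.uncurry v) (Set.Iio 0 ×ˢ Set.univ))
    {l : ℕ} {P : MvPolynomial (Fin 3) ℝ} (hl : 2 ≤ l) (hP : P.IsHomogeneous l) (hP0 : P ≠ 0)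
    (hharm : ∀ y : EuclideanSpace ℝ (Fin 3),
      Laplacian.laplacian (fun z : EuclideanSpace ℝ (Fin 3) => MvPolynomial.eval (fun i => z i) P) y = 0)
    (hrep : ∀ t < 0, ∃ (g : ℝ → ℝ) (φ : EuclideanSpace ℝ (Fin 3) → ℝ), ∀ x,
      v t x = gradient φ x + (g ‖x - x₀‖ * MvPolynomial.eval (fun i => (x - x₀) i) P) • (x - x₀))
    {t : ℝ} (ht : t < 0) {ĝ a k c e : ℝ → ℝ}
    (hcurl : ∀ x : EuclideanSpace ℝ (Fin 3), x ≠ x₀ →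
      curl (v t) x = ĝ ‖x - x₀‖ •
        cross (gradient (fun z : EuclideanSpace ℝ (Fin 3) => MvPolynomial.eval (fun i => z i) P) (x - x₀)) (x - x₀))
    (ha : ∀ r, 0 < r → DifferentiableAt ℝ a r) (hk : ∀ r, 0 < r → DifferentiableAt ℝ k r)
    (hc : ∀ r, 0 < r → DifferentiableAt ℝ c r) (he : ∀ r, 0 < r → DifferentiableAt ℝ e r)
    (hG : ∀ r, 0 < r → ĝ r = a r - deriv k r / r)
    (hdiv : ∀ r, 0 < r → r * deriv a r + ((l : ℝ) + 3) * a r + (l : ℝ) * deriv k r / r = 0)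
    (hid : ∀ y : EuclideanSpace ℝ (Fin 3), y ≠ 0 →
      -((c ‖y‖ * MvPolynomial.eval (fun i => y i) P) •
          cross (gradient (fun z : EuclideanSpace ℝ (Fin 3) => MvPolynomial.eval (fun i => z i) P) y) y) -
        (ĝ ‖y‖ * k ‖y‖) • cross (gradient (fun z : EuclideanSpace ℝ (Fin 3) =>
          ⟪gradient (fun w : EuclideanSpace ℝ (Fin 3) => MvPolynomial.eval (fun i => w i) P) z,
            gradient (fun w : EuclideanSpace ℝ (Fin 3) => MvPolynomial.eval (fun i => w i) P) z⟫) y) y -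
        e ‖y‖ • cross (gradient (fun z : EuclideanSpace ℝ (Fin 3) => MvPolynomial.eval (fun i => z i) P) y) y = 0) :
    (∃ b : EuclideanSpace ℝ (Fin 3), ∀ x, v t x = b) ∨
      (l = 2 ∧ ∃ a : EuclideanSpace ℝ (Fin 3), a ≠ 0 ∧ ∀ y : EuclideanSpace ℝ (Fin 3),
        det3 a y (gradient (fun z : EuclideanSpace ℝ (Fin 3) => MvPolynomial.eval (fun i => z i) P) y) = 0) := by
  obtain ⟨ĝ', hĝ'an, hcurl', hbdd', hconst'⟩ :=
    singleDegree_vorticity_structure_centre v x₀ hB hm hsm hl hP hP0 hharm hrep t ht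
  -- the profile (again)
  set Q : EuclideanSpace ℝ (Fin 3) → ℝ := fun z => MvPolynomial.eval (fun i => z i) P with hQ
  have hQω : ContDiff ℝ ω Q := contDiff_omega_evalPoly P
  have hQhom : ∀ r : ℝ, 0 < r → ∀ y : EuclideanSpace ℝ (Fin 3), Q (r • y) = r ^ l * Q y :=
    fun r _ y => evalPoly_smul hP r y
  have hl1 : 1 ≤ l := by omega
  have hQne : ∃ y, Q y ≠ 0 := exists_evalPoly_ne_zero hP0
  obtain ⟨ξ, hξ1, hξ⟩ := exists_unit_cross_gradient_ne_zero hQω hl1 hQhom hharm hQne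
  have hΛhom : ∀ r : ℝ, 0 < r → ∀ y : EuclideanSpace ℝ (Fin 3),
      cross (gradient Q (r • y)) (r • y) = r ^ l • cross (gradient Q y) y :=
    fun r hr y => cross_gradient_smul_of_homogeneous (hQω.differentiable (by simp)) hQhom hr y
  -- `ĝ = ĝ'` on `(0,∞)`, so `ĝ` is analytic there and obeys the centre bound
  have heq : ∀ r, 0 < r → ĝ r = ĝ' r :=
    vortAmp_eq_of_repr (Λ := fun y => cross (gradient Q y) y) hΛhom hξ1 hξ hcurl hcurl'
  have hĝan : AnalyticOnNhd ℝ ĝ (Ioi 0) := hĝ'an.congr isOpen_Ioi fun r hr => (heq r hr).symm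
  have hbdd : ∃ C, ∀ r, 0 < r → r < 1 → |ĝ r| * r ^ l ≤ C := by
    obtain ⟨C, hC⟩ := hbdd'
    exact ⟨C, fun r hr hr1 => by rw [heq r hr]; exact hC r hr hr1⟩
  have hd : ∀ r, 0 < r → DifferentiableAt ℝ (fun s => ĝ s * k s) r :=
    fun r hr => ((hĝan r hr).differentiableAt).mul (hk r hr)
  rcases evenRung_dichotomy_of_laplacian hl hP hharm hQne (d := fun s => ĝ s * k s) hc hd he hid with hd0 | hz
  · left
    have hG0 : ∀ r, 0 < r → ĝ r = 0 := odeBranch_vortAmp_eq_zero ha hk hG hdiv hĝan (fun r hr => hd0 r hr) hbdd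
    exact hconst' fun r hr => (heq r hr) ▸ hG0 r hr
  · exact Or.inr hz

/-- ★★ **COROLLARY: IN DEGREE `l ≥ 3` THE SLICE IS CONSTANT** from the same (E1) data (the zonal alternative needs `l = 2`).
[folklore] -/
theorem slice_const_of_rung_of_three_le
    (v : ℝ → EuclideanSpace ℝ (Fin 3) → EuclideanSpace ℝ (Fin 3)) (x₀ : EuclideanSpace ℝ (Fin 3))
    (hB : Literature.Analysis.FluidPDE.IsBoundedAncientMildSolution 1 v)
    (hm : ∀ t < 0, AEStronglyMeasurable (v t) volume)
    (hsm : ContDiffOn ℝ (⊤ : ℕ∞) (Function.uncurry v) (Set.Iio 0 ×ˢ Set.univ))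
    {l : ℕ} {P : MvPolynomial (Fin 3) ℝ} (hl : 3 ≤ l) (hP : P.IsHomogeneous l) (hP0 : P ≠ 0)
    (hharm : ∀ y : EuclideanSpace ℝ (Fin 3),
      Laplacian.laplacian (fun z : EuclideanSpace ℝ (Fin 3) => MvPolynomial.eval (fun i => z i) P) y = 0)
    (hrep : ∀ t < 0, ∃ (g : ℝ → ℝ) (φ : EuclideanSpace ℝ (Fin 3) → ℝ), ∀ x,
      v t x = gradient φ x + (g ‖x - x₀‖ * MvPolynomial.eval (fun i => (x - x₀) i) P) • (x - x₀))
    {t : ℝ} (ht : t < 0) {ĝ a k c e : ℝ → ℝ}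
    (hcurl : ∀ x : EuclideanSpace ℝ (Fin 3), x ≠ x₀ →
      curl (v t) x = ĝ ‖x - x₀‖ •
        cross (gradient (fun z : EuclideanSpace ℝ (Fin 3) => MvPolynomial.eval (fun i => z i) P) (x - x₀)) (x - x₀))
    (ha : ∀ r, 0 < r → DifferentiableAt ℝ a r) (hk : ∀ r, 0 < r → DifferentiableAt ℝ k r)
    (hc : ∀ r, 0 < r → DifferentiableAt ℝ c r) (he : ∀ r, 0 < r → DifferentiableAt ℝ e r)
    (hG : ∀ r, 0 < r → ĝ r = a r - deriv k r / r)
    (hdiv : ∀ r, 0 < r → r * deriv a r + ((l : ℝ) + 3) * a r + (l : ℝ) * deriv k r / r = 0)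
    (hid : ∀ y : EuclideanSpace ℝ (Fin 3), y ≠ 0 →
      -((c ‖y‖ * MvPolynomial.eval (fun i => y i) P) •
          cross (gradient (fun z : EuclideanSpace ℝ (Fin 3) => MvPolynomial.eval (fun i => z i) P) y) y) -
        (ĝ ‖y‖ * k ‖y‖) • cross (gradient (fun z : EuclideanSpace ℝ (Fin 3) =>
          ⟪gradient (fun w : EuclideanSpace ℝ (Fin 3) => MvPolynomial.eval (fun i => w i) P) z,
            gradient (fun w : EuclideanSpace ℝ (Fin 3) => MvPolynomial.eval (fun i => w i) P) z⟫) y) y -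
        e ‖y‖ • cross (gradient (fun z : EuclideanSpace ℝ (Fin 3) => MvPolynomial.eval (fun i => z i) P) y) y = 0) :
    ∃ b : EuclideanSpace ℝ (Fin 3), ∀ x, v t x = b := by
  rcases evenRung_slice_alternative_of_rung v x₀ hB hm hsm (by omega) hP hP0 hharm hrep ht hcurl ha hk hc he hG hdiv hid
    with h | ⟨h2, -⟩
  · exact h
  · omega

end Summit.NavierStokesRegularity.NavierStokesRegularity.Theorems.PoloidalLiouville.Antidynamo

end
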